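import Literature.NumberTheory.EllipticCurves.KatoTwistedFiniteness
import Mathlib.RingTheory.Polynomial.Cyclotomic.Roots
import Mathlib.RingTheory.AdjoinRoot
import Mathlib.RingTheory.IntegralDomain
import Mathlib.RepresentationTheory.Basic
import Mathlib.GroupTheory.Index
import HarnessLib

/-!
# Kato's remark: `χ`-parts versus `χ`-quotients (integral quasi-idempotents)

K. Kato, *`p`-adic Hodge theory and values of zeta functions of modular forms*, Astérisque 295
(2004), states Thm. 14.2 (2) and Cor. 14.3 for the `χ`-PARTS `M^(χ) = {x ∈ M ; I_χ x = 0}` of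
`G = Gal(K/ℚ)`-modules (`I_χ = ker(χ : ℤ[G] → ℂ)`; the tree's
`Literature.NumberTheory.EllipticCurves.chiPart`, file `KatoTwistedFiniteness.lean`) and remarks
(p. 236): *"We can replace the "`χ`-parts" `Sel(K, T)^(χ)`, `Sel(K, A ⊗_ℚ K)^(χ)` and `A(K)^(χ)`
in 14.2 and 14.3 by the "`χ`-quotients" `Sel(K, T)_(χ)`, `Sel(K, A ⊗_ℚ K)_(χ)` and `A(K)_(χ)`,
respectively, where `M_(χ) = M/I_χ M` for a `G`-module `M`. This is because the kernel and the
cokernel of the canonical map `M^(χ) → M_(χ)` are killed by some non-zero integer, and because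
for `M = Sel(K, T)`, `Sel(K, A ⊗_ℚ K)` or `A(K)`, the kernel and the cokernel of `n : M → M` are
finite for any non-zero integer `n`."*

This file PROVES the algebraic half of that remark for any finite abelian group `G`, any
character `χ : G → K` with values in a field of characteristic zero and any `ℤ`-linear
representation `ρ` of `G` on an abelian group `M` (Mathlib `Representation ℤ G M`), with the
explicit integer `n = #G`:

* `card_smul_mem_chiPart_sup_closure` — `#G · x ∈ M^(χ) + I_χ M` for every `x ∈ M`
  (the cokernel of `M^(χ) → M/I_χ M` is killed by `#G`);
* `card_smul_eq_zero_of_mem_chiPart_of_mem_closure` — `#G` kills `M^(χ) ∩ I_χ M`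
  (the kernel of `M^(χ) → M/I_χ M` is killed by `#G`).

Both follow from an **integral quasi-idempotent** (`exists_quasiIdempotent`,
`exists_quasiProjector_chiPart`): an element `v ∈ ℤ[G]` with `χ(v) = #G` and `v · I_χ = 0`, so
that `v` maps `M` into `M^(χ)` and acts on `M^(χ)` as `#G` (rationally, `v = #G · e_{[χ]}` is the
sum of the primitive idempotents of the `ℚ`-conjugates of `χ`; the proof here is elementary and
Galois-free: with `ζ = χ(g₀)` a generator of the cyclic image of `χ`, of order `d`, and
`H = ker χ`, one takes `v = N_H · Ξ_d(g₀)` for the integer polynomial `Ξ_d = Ψ_d · X · Φ_d'`,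
`Ψ_d Φ_d = X^d - 1`, which satisfies `Ξ_d(ζ) = d` and `X^d - 1 ∣ Ξ_d p` whenever `p(ζ) = 0`).
The dictionary between `chiPart` (finitely supported integer vectors) and the group ring
(Mathlib `MonoidAlgebra`, `MonoidAlgebra.lift`, `Representation.asAlgebraHom`) is
`mem_chiPart_iff_asAlgebraHom`.

## What is NOT here

* The second half of Kato's sentence (finiteness of kernel and cokernel of `n : M → M` on Selmer
  and Mordell–Weil groups) and the `χ`-quotient versions of Thm. 14.2 / Cor. 14.3 themselves
  (the `χ`-part versions are the cited named facts of `KatoTwistedFiniteness.lean`).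
* Non-abelian `G` (Kato's `G = Gal(K/ℚ)` is abelian).

## References

* K. Kato, *`p`-adic Hodge theory and values of zeta functions of modular forms*, Astérisque 295
  (2004), 117–290, §14: Thm. 14.2, Cor. 14.3 (p. 235) and the remark following them (p. 236).
  [Kato2004Asterisque]
-/

noncomputable section

open Polynomial

namespace Literature.NumberTheory.EllipticCurves

/-! ### Two polynomial identities around `X^d - 1 = Ψ_d Φ_d` -/

section Poly

variable {K : Type*} [Field K] {d : ℕ} {ζ : K}

/-- `Ψ_d Φ_d = X^d - 1` over `ℤ`, where `Ψ_d = ∏_{e ∣ d, e < d} Φ_e` (Mathlib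
`prod_cyclotomic_eq_X_pow_sub_one`, split off the factor `e = d`). [folklore] -/
theorem prod_cyclotomic_properDivisors_mul_cyclotomic (hd : 0 < d) :
    (∏ i ∈ Nat.properDivisors d, cyclotomic i ℤ) * cyclotomic d ℤ = X ^ d - 1 := by
  rw [← prod_cyclotomic_eq_X_pow_sub_one hd, ← Nat.cons_self_properDivisors hd.ne',
    Finset.prod_cons, mul_comm]

/-- With `Ξ_d = Ψ_d · X · Φ_d'`: if `Φ_d ∣ p` then `X^d - 1 ∣ Ξ_d p`. [folklore] -/
theorem X_pow_sub_one_dvd_quasiIdemPoly_mul (hd : 0 < d) {p : ℤ[X]} (hp : cyclotomic d ℤ ∣ p) :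
    X ^ d - 1 ∣
      ((∏ i ∈ Nat.properDivisors d, cyclotomic i ℤ) * (X * derivative (cyclotomic d ℤ))) * p := by
  obtain ⟨q, rfl⟩ := hp
  refine ⟨X * derivative (cyclotomic d ℤ) * q, ?_⟩
  rw [← prod_cyclotomic_properDivisors_mul_cyclotomic hd]; ring

/-- `Ξ_d(ζ) = d` at a primitive `d`-th root of unity `ζ`: differentiate `Ψ_d Φ_d = X^d - 1` and
evaluate at `ζ`, where `Φ_d(ζ) = 0`, to get `Ψ_d(ζ) Φ_d'(ζ) = d ζ^{d-1}`. [folklore] -/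
theorem aeval_quasiIdemPoly (hd : 0 < d) (hζ : IsPrimitiveRoot ζ d) :
    aeval ζ ((∏ i ∈ Nat.properDivisors d, cyclotomic i ℤ) * (X * derivative (cyclotomic d ℤ))) =
      d := by
  have hroot : aeval ζ (cyclotomic d ℤ) = 0 := by
    rw [aeval_def, eval₂_eq_eval_map, map_cyclotomic, ← IsRoot.def]
    exact hζ.isRoot_cyclotomic hd
  have hder := congrArg (fun p => aeval ζ (derivative p))
    (prod_cyclotomic_properDivisors_mul_cyclotomic (d := d) hd)
  simp only [derivative_mul, derivative_sub, derivative_X_pow, derivative_one, sub_zero, map_add,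
    map_mul, hroot, mul_zero, zero_add, map_natCast, map_pow, aeval_X] at hder
  have : aeval ζ
      ((∏ i ∈ Nat.properDivisors d, cyclotomic i ℤ) * (X * derivative (cyclotomic d ℤ))) =
      ζ * (aeval ζ (∏ i ∈ Nat.properDivisors d, cyclotomic i ℤ) *
        aeval ζ (derivative (cyclotomic d ℤ))) := by
    rw [map_mul, map_mul, aeval_X]; ring
  rw [this, hder, ← mul_assoc, mul_comm ζ, mul_assoc, ← pow_succ', Nat.sub_add_cancel hd,
    hζ.pow_eq_one, mul_one]

/-- An integer polynomial vanishing at a primitive `d`-th root of unity in a field of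
characteristic zero is divisible by `Φ_d` over `ℤ` (`Φ_d` is the minimal polynomial, Mathlib
`cyclotomic_eq_minpoly`, and `ℤ` is integrally closed). [folklore] -/
theorem cyclotomic_dvd_of_aeval_eq_zero [CharZero K] (hd : 0 < d) (hζ : IsPrimitiveRoot ζ d)
    {p : ℤ[X]} (hp : aeval ζ p = 0) : cyclotomic d ℤ ∣ p := by
  rw [cyclotomic_eq_minpoly hζ hd]
  exact minpoly.isIntegrallyClosed_dvd (hζ.isIntegral hd) hp

end Poly

/-! ### The integral quasi-idempotent of a character of a finite abelian group -/

section GroupRing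

variable {G : Type*} [CommGroup G] [Fintype G] {K : Type*} [Field K]

/-- The image of a character `χ : G → Kˣ` of a finite abelian group is cyclic (a finite subgroup
of `Kˣ`): there are `d ≥ 1` and a primitive `d`-th root of unity `ζ = χ(g₀)` such that every
`χ(g)` is a `d`-th root of unity, and `#ker χ · d = #G`. [folklore] -/
theorem exists_isPrimitiveRoot_of_character (χ : G →* K) :
    ∃ d : ℕ, 0 < d ∧ ∃ ζ : K, IsPrimitiveRoot ζ d ∧ (∃ g₀ : G, χ g₀ = ζ) ∧
      (∀ g : G, χ g ^ d = 1) ∧ Nat.card {g : G // χ g = 1} * d = Nat.card G := by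
  classical
  let χu : G →* Kˣ := χ.toHomUnits
  let S : Subgroup Kˣ := χu.range
  obtain ⟨s, hs⟩ := IsCyclic.exists_generator (α := S)
  have hord : orderOf s = Nat.card S := orderOf_eq_card_of_forall_mem_zpowers hs
  let ι : S →* K := (Units.coeHom K).comp S.subtype
  have hι : Function.Injective ι := Units.val_injective.comp Subtype.val_injective
  refine ⟨orderOf s, orderOf_pos s, ((s : Kˣ) : K), ?_, ?_, ?_, ?_⟩
  · have h := IsPrimitiveRoot.orderOf (ι s)
    rwa [orderOf_injective ι hι s] at h
  · obtain ⟨g₀, hg₀⟩ := s.2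
    exact ⟨g₀, by rw [← hg₀]; rfl⟩
  · intro g
    have hmem : χu g ∈ S := ⟨g, rfl⟩
    have h1 : (⟨χu g, hmem⟩ : S) ^ Nat.card S = 1 := pow_card_eq_one'
    have h2 := congrArg ι h1
    rw [map_pow, map_one] at h2
    rw [hord]
    exact h2
  · rw [hord, ← Subgroup.index_ker χu, mul_comm]
    have hker : Nat.card {g : G // χ g = 1} = Nat.card χu.ker := by
      refine Nat.card_congr (Equiv.subtypeEquivRight fun g => ?_)
      rw [MonoidHom.mem_ker, Units.ext_iff]
      rfl
    rw [hker, mul_comm, Subgroup.card_mul_index]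

/-- **Integral quasi-idempotent of a character.** For a character `χ` of a finite abelian group
`G` with values in a field `K` of characteristic zero, extended to the ring homomorphism
`χ : ℤ[G] → K` (Mathlib `MonoidAlgebra.lift`) with kernel `I_χ`, there is `v ∈ ℤ[G]` with
`χ(v) = #G` and `v · I_χ = 0`. (So `v ≡ #G (mod I_χ)`; rationally `v = #G · e_{[χ]}` for the
idempotent of the `ℚ`-conjugacy class of `χ`, but no Galois theory is used.) Construction: if
`ζ = χ(g₀)` generates the (cyclic, of order `d`) image of `χ` and `H = ker χ`, let
`θ : ℤ[G] → ℤ[X]/(X^d - 1)`, `g ↦ X^{k(g)}` where `χ(g) = ζ^{k(g)}`; then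
`χ = ev_ζ ∘ θ`, an element of `I_χ` maps to a polynomial vanishing at `ζ`, hence divisible by
`Φ_d`, hence killed by `Ξ_d = Ψ_d X Φ_d'` modulo `X^d - 1`; and `N_H · x = 0` whenever
`θ(x) = 0` (`N_H x` is `Λ(θ x)` for the `ℤ`-linear `Λ : X^i ↦ N_H g₀^i`, since `N_H g` only
depends on `χ(g)`). Then `v = N_H · Ξ_d(g₀)` works: `χ(v) = #H · Ξ_d(ζ) = #H · d = #G`
(`aeval_quasiIdemPoly`). [folklore] -/
theorem exists_quasiIdempotent [CharZero K] (χ : G →* K) :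
    ∃ v : MonoidAlgebra ℤ G,
      MonoidAlgebra.lift ℤ K G χ v = Fintype.card G ∧
      ∀ a : MonoidAlgebra ℤ G, MonoidAlgebra.lift ℤ K G χ a = 0 → v * a = 0 := by
  classical
  obtain ⟨d, hd, ζ, hζ, ⟨g₀, hg₀⟩, hpow, hcard⟩ := exists_isPrimitiveRoot_of_character χ
  haveI : NeZero d := ⟨hd.ne'⟩
  -- exponents `k g` with `χ g = ζ ^ k g`
  have hk : ∀ g : G, ∃ i, i < d ∧ ζ ^ i = χ g := fun g => by
    obtain ⟨i, hi, h⟩ := hζ.eq_pow_of_pow_eq_one (hpow g)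
    exact ⟨i, hi, h⟩
  choose k hk_lt hk_eq using hk
  -- the ring `P = ℤ[X]/(X^d - 1)` and its root `Xb`
  set f : ℤ[X] := X ^ d - 1 with hf
  have hfm : f.Monic := monic_X_pow_sub_C 1 hd.ne'
  have hfd : f.natDegree = d := natDegree_X_pow_sub_C
  set Xb : AdjoinRoot f := AdjoinRoot.root f with hXb
  have hXd : Xb ^ d = 1 := by
    have h : aeval (AdjoinRoot.root f) f = 0 := by rw [AdjoinRoot.aeval_eq, AdjoinRoot.mk_self]
    rw [hf, map_sub, map_pow, aeval_X, map_one, sub_eq_zero] at h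
    exact h
  have hXpow : ∀ {i j : ℕ}, ζ ^ i = ζ ^ j → Xb ^ i = Xb ^ j := fun {i j} hij => by
    rw [(hζ.isOfFinOrder hd.ne').pow_eq_pow_iff_modEq, ← hζ.eq_orderOf] at hij
    rw [pow_eq_pow_mod i hXd, pow_eq_pow_mod j hXd, hij]
  -- `θ : G →* P`, `g ↦ Xb ^ k g`, and `Θ : ℤ[G] → P`
  let θ : G →* AdjoinRoot f :=
    { toFun := fun g => Xb ^ k g
      map_one' := by
        have h : ζ ^ k 1 = ζ ^ 0 := by rw [hk_eq, map_one, pow_zero]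
        rw [hXpow h, pow_zero]
      map_mul' := fun a b => by
        have h : ζ ^ k (a * b) = ζ ^ (k a + k b) := by rw [hk_eq, map_mul, pow_add, hk_eq, hk_eq]
        rw [← pow_add, hXpow h] }
  have hθ : ∀ g, θ g = Xb ^ k g := fun g => rfl
  let Θ : MonoidAlgebra ℤ G →ₐ[ℤ] AdjoinRoot f := MonoidAlgebra.lift ℤ (AdjoinRoot f) G θ
  -- `ev : P →+* K`, `Xb ↦ ζ`
  let ev : AdjoinRoot f →+* K := AdjoinRoot.lift (Int.castRingHom K) ζ (by
    rw [hf, eval₂_sub, eval₂_X_pow, eval₂_one, hζ.pow_eq_one, sub_self])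
  have hev_mk : ∀ p : ℤ[X], ev (AdjoinRoot.mk f p) = aeval ζ p := fun p => by
    rw [AdjoinRoot.lift_mk, aeval_def, algebraMap_int_eq]
  have hev_Xb : ev Xb = ζ := AdjoinRoot.lift_root _
  -- `χ = ev ∘ Θ` on `ℤ[G]`
  have hE : ∀ a : MonoidAlgebra ℤ G, MonoidAlgebra.lift ℤ K G χ a = ev (Θ a) := fun a => by
    induction a using MonoidAlgebra.induction_on with
    | hM g =>
      rw [MonoidAlgebra.lift_of, MonoidAlgebra.lift_of, hθ, map_pow, hev_Xb, hk_eq]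
    | hadd x y hx hy => rw [map_add, map_add, map_add, hx, hy]
    | hsmul r x hx => rw [map_zsmul, map_zsmul, map_zsmul, hx]
  -- the norm element `N = ∑_{χ h = 1} h`; `N g` only depends on `χ g`
  set N : MonoidAlgebra ℤ G := ∑ g, (if χ g = 1 then MonoidAlgebra.of ℤ G g else 0) with hN
  have hN_ker : ∀ h₀ : G, χ h₀ = 1 → N * MonoidAlgebra.of ℤ G h₀ = N := fun h₀ hh₀ => by
    rw [hN, Finset.sum_mul]
    refine Fintype.sum_equiv (Equiv.mulRight h₀) _ _ fun g => ?_
    simp only [Equiv.coe_mulRight, map_mul, hh₀, mul_one]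
    split_ifs <;> simp
  have hχne : ∀ g : G, χ g ≠ 0 := fun g h => by
    have := hpow g
    rw [h, zero_pow hd.ne'] at this
    exact zero_ne_one this
  have hN_coset : ∀ g g' : G, χ g = χ g' →
      N * MonoidAlgebra.of ℤ G g = N * MonoidAlgebra.of ℤ G g' := fun g g' hgg' => by
    have h0 : χ (g⁻¹ * g') = 1 := by
      rw [map_mul, map_inv, hgg', inv_mul_cancel₀ (hχne g')]
    conv_rhs => rw [← mul_inv_cancel_left g g', map_mul, ← mul_assoc, mul_right_comm, hN_ker _ h0]
  -- the `ℤ`-linear `Λ : P → ℤ[G]`, `Xb ^ i ↦ N g₀^i`, with `N * x = Λ (Θ x)`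
  let pb : PowerBasis ℤ (AdjoinRoot f) := AdjoinRoot.powerBasis' hfm
  have hpb_dim : pb.dim = d := by rw [AdjoinRoot.powerBasis'_dim, hfd]
  have hpb_gen : pb.gen = Xb := AdjoinRoot.powerBasis'_gen hfm
  let Λ : AdjoinRoot f →ₗ[ℤ] MonoidAlgebra ℤ G :=
    pb.basis.constr ℤ fun i => N * MonoidAlgebra.of ℤ G (g₀ ^ (i : ℕ))
  have hΛ : ∀ g : G, Λ (Xb ^ k g) = N * MonoidAlgebra.of ℤ G g := fun g => by
    have hi : k g < pb.dim := hpb_dim ▸ hk_lt g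
    have : Xb ^ k g = pb.basis ⟨k g, hi⟩ := by rw [pb.basis_eq_pow, hpb_gen]
    rw [this, Module.Basis.constr_basis]
    refine hN_coset _ _ ?_
    rw [map_pow, hg₀, hk_eq]
  have hL : ∀ x : MonoidAlgebra ℤ G, N * x = Λ (Θ x) := fun x => by
    induction x using MonoidAlgebra.induction_on with
    | hM g => rw [MonoidAlgebra.lift_of, hθ, hΛ]
    | hadd x y hx hy => rw [mul_add, map_add, map_add, hx, hy]
    | hsmul r x hx => rw [mul_smul_comm, map_zsmul, map_zsmul, hx]
  -- the element `w = Ξ_d(g₀)` with `Θ w = Ξ_d mod (X^d - 1)`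
  set w : MonoidAlgebra ℤ G := aeval (MonoidAlgebra.of ℤ G g₀)
    ((∏ i ∈ Nat.properDivisors d, cyclotomic i ℤ) * (X * derivative (cyclotomic d ℤ))) with hw
  have hΘg₀ : Θ (MonoidAlgebra.of ℤ G g₀) = Xb := by
    rw [MonoidAlgebra.lift_of, hθ]
    have h : ζ ^ k g₀ = ζ ^ 1 := by rw [hk_eq, hg₀, pow_one]
    rw [hXpow h, pow_one]
  have hΘw : Θ w = AdjoinRoot.mk f
      ((∏ i ∈ Nat.properDivisors d, cyclotomic i ℤ) * (X * derivative (cyclotomic d ℤ))) := by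
    rw [hw, ← aeval_algHom_apply, hΘg₀, hXb, AdjoinRoot.aeval_eq]
  refine ⟨N * w, ?_, fun a ha => ?_⟩
  · -- `χ(N w) = #ker χ · Ξ_d(ζ) = #ker χ · d = #G`
    have hEof : ∀ g : G, ev (Θ (MonoidAlgebra.of ℤ G g)) = χ g := fun g => by
      rw [← hE, MonoidAlgebra.lift_of]
    have hΘN : ev (Θ N) = Nat.card {g : G // χ g = 1} := by
      rw [hN, map_sum, map_sum]
      have h : ∀ g : G, ev (Θ (if χ g = 1 then MonoidAlgebra.of ℤ G g else 0)) =
          if χ g = 1 then (1 : K) else 0 := fun g => by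
        split_ifs with h1
        · rw [hEof, h1]
        · rw [map_zero, map_zero]
      rw [Finset.sum_congr rfl fun g _ => h g, Finset.sum_boole, Nat.card_eq_fintype_card,
        Fintype.card_subtype]
    rw [hE, map_mul, map_mul, hΘN, hΘw, hev_mk, aeval_quasiIdemPoly hd hζ, ← Nat.cast_mul, hcard,
      Nat.card_eq_fintype_card]
  · -- `Θ a` vanishes at `ζ`, so `Φ_d` divides a lift of it and `Θ (w a) = 0`, so `N w a = 0`
    obtain ⟨p, hp⟩ := AdjoinRoot.mk_surjective (Θ a)
    have hp0 : aeval ζ p = 0 := by rw [← hev_mk, hp, ← hE, ha]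
    have hwa : Θ (w * a) = 0 := by
      rw [map_mul, hΘw, ← hp, ← map_mul, AdjoinRoot.mk_eq_zero]
      exact X_pow_sub_one_dvd_quasiIdemPoly_mul hd (cyclotomic_dvd_of_aeval_eq_zero hd hζ hp0)
    rw [mul_assoc, hL, hwa, map_zero]

end GroupRing

/-! ### Kato's `χ`-parts through the group ring; `χ`-parts versus `χ`-quotients -/

section ChiPart

variable {G : Type*} [CommGroup G] {K : Type*} [Field K] {M : Type*} [AddCommGroup M]

/-- The ring homomorphism `χ : ℤ[G] → K` on an element with coefficient vector `a` is
`∑ a_g χ(g)` — the functional cutting out `I_χ` in `chiPart`. [folklore] -/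
theorem lift_ofCoeff_eq_sum (χ : G →* K) (a : G →₀ ℤ) :
    MonoidAlgebra.lift ℤ K G χ (MonoidAlgebra.ofCoeff a) = a.sum fun g n => (n : K) * χ g := by
  rw [MonoidAlgebra.lift_apply, MonoidAlgebra.coeff_ofCoeff]
  exact Finsupp.sum_congr fun g _ => zsmul_eq_mul _ _

/-- The action of `ℤ[G]` on a representation (`Representation.asAlgebraHom`) on an element with
coefficient vector `a` is `x ↦ ∑ a_g ρ(g) x` — the action used in `chiPart`. [folklore] -/
theorem asAlgebraHom_ofCoeff_apply (ρ : Representation ℤ G M) (a : G →₀ ℤ) (x : M) :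
    ρ.asAlgebraHom (MonoidAlgebra.ofCoeff a) x = a.sum fun g n => n • ρ g x := by
  rw [Representation.asAlgebraHom_def, MonoidAlgebra.lift_apply, MonoidAlgebra.coeff_ofCoeff]
  simp only [Finsupp.sum, LinearMap.coe_sum, Finset.sum_apply, LinearMap.smul_apply]

/-- **Kato's `χ`-part through the group ring.** For a `ℤ`-linear representation `ρ` of `G` on
`M` and a character `χ : G → K`, `x ∈ M^(χ)` (`chiPart`, Kato, Astérisque 295, p. 235:
`{x ; I_χ x = 0}`) iff every `a ∈ ℤ[G]` with `χ(a) = 0` acts by zero on `x`. [folklore] -/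
theorem mem_chiPart_iff_asAlgebraHom (ρ : Representation ℤ G M) (χ : G →* K) (x : M) :
    x ∈ chiPart (fun g => (ρ g).toAddMonoidHom) χ ↔
      ∀ a : MonoidAlgebra ℤ G, MonoidAlgebra.lift ℤ K G χ a = 0 → ρ.asAlgebraHom a x = 0 := by
  rw [mem_chiPart_iff, MonoidAlgebra.forall]
  refine forall_congr' fun a => ?_
  rw [lift_ofCoeff_eq_sum, asAlgebraHom_ofCoeff_apply]
  rfl

variable [Fintype G] [CharZero K]

/-- **The quasi-projector onto the `χ`-part.** For a `ℤ`-linear representation `ρ` of a finite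
abelian group `G` and a character `χ` (values in a field of characteristic zero), the integral
quasi-idempotent `v ∈ ℤ[G]` of `exists_quasiIdempotent` (`χ(v) = #G`, `v I_χ = 0`) maps `M` into
`M^(χ)` and acts on `M^(χ)` as multiplication by `#G`. [folklore] -/
theorem exists_quasiProjector_chiPart (ρ : Representation ℤ G M) (χ : G →* K) :
    ∃ v : MonoidAlgebra ℤ G,
      MonoidAlgebra.lift ℤ K G χ v = Fintype.card G ∧
      (∀ a : MonoidAlgebra ℤ G, MonoidAlgebra.lift ℤ K G χ a = 0 → v * a = 0) ∧
      (∀ x : M, ρ.asAlgebraHom v x ∈ chiPart (fun g => (ρ g).toAddMonoidHom) χ) ∧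
      ∀ x ∈ chiPart (fun g => (ρ g).toAddMonoidHom) χ,
        ρ.asAlgebraHom v x = (Fintype.card G : ℤ) • x := by
  obtain ⟨v, hv1, hv2⟩ := exists_quasiIdempotent χ
  refine ⟨v, hv1, hv2, fun x => ?_, fun x hx => ?_⟩
  · rw [mem_chiPart_iff_asAlgebraHom]
    intro a ha
    rw [← Module.End.mul_apply, ← map_mul, mul_comm, hv2 a ha, map_zero, LinearMap.zero_apply]
  · have h0 : MonoidAlgebra.lift ℤ K G χ (v - (Fintype.card G : ℤ) • 1) = 0 := by
      rw [map_sub, map_zsmul, map_one, hv1, zsmul_eq_mul, mul_one, Int.cast_natCast, sub_self]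
    have h := (mem_chiPart_iff_asAlgebraHom ρ χ x).mp hx _ h0
    rwa [map_sub, map_zsmul, map_one, LinearMap.sub_apply, LinearMap.smul_apply,
      Module.End.one_apply, sub_eq_zero] at h

/-- **Kato's remark, cokernel half** (Astérisque 295, p. 236: "the kernel and the cokernel of the
canonical map `M^(χ) → M_(χ) = M/I_χM` are killed by some non-zero integer"): for every
`x ∈ M`, `#G · x ∈ M^(χ) + I_χ M`, i.e. `#G` kills the cokernel of `M^(χ) → M/I_χ M`. Here
`I_χ M` is the subgroup generated by the `a · z`, `a ∈ I_χ`. Indeed `#G · x = v x + (#G - v) x`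
with `v x ∈ M^(χ)` and `#G - v ∈ I_χ` (`exists_quasiProjector_chiPart`).
[cite: Kato2004Asterisque, §14 remark after Cor. 14.3 (p. 236)] -/
theorem card_smul_mem_chiPart_sup_closure (ρ : Representation ℤ G M) (χ : G →* K) (x : M) :
    (Fintype.card G : ℤ) • x ∈ chiPart (fun g => (ρ g).toAddMonoidHom) χ ⊔
      AddSubgroup.closure {y : M | ∃ a : MonoidAlgebra ℤ G,
        MonoidAlgebra.lift ℤ K G χ a = 0 ∧ ∃ z : M, y = ρ.asAlgebraHom a z} := by
  obtain ⟨v, hv1, -, hv3, -⟩ := exists_quasiProjector_chiPart ρ χ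
  rw [AddSubgroup.mem_sup]
  refine ⟨ρ.asAlgebraHom v x, hv3 x, ρ.asAlgebraHom ((Fintype.card G : ℤ) • 1 - v) x, ?_, ?_⟩
  · refine AddSubgroup.subset_closure ⟨_, ?_, x, rfl⟩
    rw [map_sub, map_zsmul, map_one, hv1, zsmul_eq_mul, mul_one, Int.cast_natCast, sub_self]
  · rw [map_sub, LinearMap.sub_apply, add_sub_cancel, map_zsmul, map_one, LinearMap.smul_apply,
      Module.End.one_apply]

/-- **Kato's remark, kernel half** (Astérisque 295, p. 236): an element of `M^(χ) ∩ I_χ M` is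
killed by `#G`, i.e. `#G` kills the kernel of `M^(χ) → M/I_χ M`. Indeed on `M^(χ)` the
quasi-idempotent `v` acts as `#G`, while `v` kills `I_χ M` since `v I_χ = 0`
(`exists_quasiProjector_chiPart`). Together with `card_smul_mem_chiPart_sup_closure` this is
Kato's "we can replace the `χ`-parts […] by the `χ`-quotients `M_(χ) = M/I_χ M`" for modules
on which multiplication by a non-zero integer has finite kernel and cokernel.
[cite: Kato2004Asterisque, §14 remark after Cor. 14.3 (p. 236)] -/
theorem card_smul_eq_zero_of_mem_chiPart_of_mem_closure (ρ : Representation ℤ G M)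
    (χ : G →* K) {x : M} (hx : x ∈ chiPart (fun g => (ρ g).toAddMonoidHom) χ)
    (hx' : x ∈ AddSubgroup.closure {y : M | ∃ a : MonoidAlgebra ℤ G,
        MonoidAlgebra.lift ℤ K G χ a = 0 ∧ ∃ z : M, y = ρ.asAlgebraHom a z}) :
    (Fintype.card G : ℤ) • x = 0 := by
  obtain ⟨v, -, hv2, -, hv4⟩ := exists_quasiProjector_chiPart ρ χ
  rw [← hv4 x hx]
  have hle : AddSubgroup.closure {y : M | ∃ a : MonoidAlgebra ℤ G,
      MonoidAlgebra.lift ℤ K G χ a = 0 ∧ ∃ z : M, y = ρ.asAlgebraHom a z} ≤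
      (ρ.asAlgebraHom v).toAddMonoidHom.ker := by
    rw [AddSubgroup.closure_le]
    rintro y ⟨a, ha, z, rfl⟩
    rw [SetLike.mem_coe, AddMonoidHom.mem_ker, LinearMap.toAddMonoidHom_coe,
      ← Module.End.mul_apply, ← map_mul, hv2 a ha, map_zero, LinearMap.zero_apply]
  exact hle hx'

end ChiPart

end Literature.NumberTheory.EllipticCurves

end
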